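import Summits.BirchSwinnertonDyer.Rank1Residual.X11b.KummerPoitouTateExact
import Summits.BirchSwinnertonDyer.Rank1Residual.Ordinary.KuriharaExactOrderVocabulary
import HarnessLib

/-!
# The local Tate pairing modulo the Kummer condition: `H¹_s × H¹_f → ℤ/n` in CYCLIC CURRENCY
# (theorems only — no named fact, no `sorry`; nothing about any curve's BSD)

HONEST FRAMING (cell `b2b-bsdres`, run/shared/lean/b2b/bsd-rank1-residual/, verbatim in every
file): the goal of the cell is to DELETE the COMBINATION-SHAPED residual classes of the
Birch–Swinnerton-Dyer formula for ALL analytic-rank `≤ 1` elliptic curves over `ℚ` — "full BSD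
formula for every rank `≤ 1` curve in class `C`" assembled STRICTLY from published theorems — so
that the rank-`≤ 1` remainder becomes exactly the CONSTRUCTION-SHAPED classes, which are TYPED
(missing-input `Prop`s), NOT attempted. This is not "finishing BSD". Seat `b2b-bsdres-additive-p3`
(X8 prover B / X7 joint; typer-designate for the cell conjecture C-16 = hyp C120.1 by hyp R-16 (e)).
This file books nothing and moves no mark; X7 / X8 stay CONSTRUCTION-SHAPED; C-16 stays a CONJECTURE.

## What this file does (step (iii) of `R1-DEPTH-LAW.md` §2, local half)

The depth-law skeleton (`Ordinary/DepthLawReciprocitySkeleton.lean`, `min_eq_min_of_reciprocity`) takes as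
HYPOTHESES two PERFECT pairings `Bl, Bp : ℤ/p^n × ℤ/p^n → ℤ/p^n` ("the pairing `H¹_tr × H¹_f → ℤ/p^{k′}` is
non-degenerate on both sides (free rank one each)"; at `p` "the pairing factors through
`H¹_s(ℚ_p,W) × H¹_f(ℚ_p,W)`, perfect"). Here they are PRODUCED on the tree's real local cohomology
`H¹(K_v, E[n])` (`galoisCohomology ((W.torsionGaloisModule n).toLocal v) 1`) with its Kummer condition
`𝓛_v = W.kummerSelmerStructure n v` and the pairing `inv_v(· ∪ₑ ·)` (`X11b.Relaxation.invWeilPairing`), for a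
family of local invariant maps `inv` (`LocalInvariants`; the Poitou–Tate named fact supplies one):

* §1 (algebra) for a bi-additive `b : A × A → ℤ/q` and a subgroup `L` with `{}^⊥L = L`: the descended pairing
  `(A ⧸ L) × L → ℤ/q` has trivial left kernel; `#(A ⧸ L) = #L`; and if `L ≅ ℤ/q` (`φ`) then
  `A ⧸ L ≅ ℤ/q` by a `ψ` with **`b(x, y) = ψ[x] · φ(y)`** (`exists_addEquiv_quotient_pairing_eq_mul`); two
  identifications differ by a UNIT, so `ord_p` read through any comparison `θ : L ≅ A ⧸ L` is `ord_p ∘ φ`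
  (`zmodPowOrd_comparison_eq`);
* §2 at a finite place `v` with `inv_v` injective and Tate's count `#H¹(K_v, E[n]) = #𝓛_v²`: **`{}^⊥𝓛_v = 𝓛_v`**
  (`annLeft_invWeilPairing_kummer_eq`, left twin of `X11b.KummerPT.annRight_invWeilPairing_kummer_eq`:
  Poonen–Rains isotropy + `natCard_annLeft_mul`), hence for any `φ : 𝓛_v ≅ ℤ/n` an identification
  `ψ : H¹(K_v, E[n]) ⧸ 𝓛_v ≅ ℤ/n` with `inv_v(x ∪ₑ y) = ψ[x] · φ(y)` (`exists_addEquiv_singular_pairing_eq_mul`);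
* §3 an identification `φ : E(K_v) ↠ ℤ/n` with kernel `n·E(K_v)` (the shape produced by
  `Ordinary/LocalPointsIdentification.lean` and `Ordinary/CyclicSylowQuotient.lean`) IS an identification
  `φL : 𝓛_v ≅ ℤ/n` with `φL(κ_v g) = φ(g)` (`exists_addEquiv_kummer_of_pointIdentification`; exactness of the local
  Kummer sequence), and `loc_v κ(P) = κ_v(P_v)` as elements of `𝓛_v`.

Consumer: `Ordinary/DepthLawReciprocityFromPoitouTate.lean` (the two-term reciprocity and the skeleton's
datum `Bl xl yl + Bp xp yp = 0` from the Poitou–Tate fact).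

References: J. S. Milne, *Arithmetic Duality Theorems* (2006), I Cor. 2.3, Thm. 2.8, Cor. 3.4, Lemma 6.15
[MilneADT2006]; B. Poonen, E. Rains, *Random maximal isotropic subspaces and Selmer groups* (2012), Prop. 4.10
[PoonenRains2012]; B. Mazur, K. Rubin, *Kolyvagin systems* (2004), Def. 1.2.2, Thm. 5.2.12 [MazurRubin2004];
J. H. Silverman, AEC (2009), X.§4 [SilvermanAEC2009]; `R1-DEPTH-LAW.md` §2 (iii).
-/

noncomputable section

open scoped Classical


namespace Summit.BirchSwinnertonDyer.Rank1Residual.Ordinary.ReciprocityPT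

open Function
open Summit.BirchSwinnertonDyer.Rank1Residual.X11b.FiniteDuality

/-! ### §1 Algebra: descent of a pairing to `(A ⧸ L) × L` for a maximal isotropic `L`, cyclic currency -/

section Algebra

variable {A : Type*} [AddCommGroup A] {q : ℕ}

/-- An additive endomorphism of `ℤ/q` is multiplication by its value at `1`. [folklore] -/
theorem addMonoidHom_zmod_apply (f : ZMod q →+ ZMod q) (x : ZMod q) [NeZero q] : f x = x * f 1 := by
  have hx : x = (x.val : ℤ) • (1 : ZMod q) := by
    rw [zsmul_eq_mul, mul_one]; simp
  conv_lhs => rw [hx, map_zsmul]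
  rw [zsmul_eq_mul]; simp

/-- An additive automorphism of `ℤ/q` is multiplication by a UNIT. [folklore] -/
theorem isUnit_addEquiv_zmod_apply_one [NeZero q] (f : ZMod q ≃+ ZMod q) : IsUnit (f 1) := by
  have h : f.symm 1 * f 1 = 1 := by
    have := addMonoidHom_zmod_apply f.toAddMonoidHom (f.symm 1)
    simp only [AddEquiv.coe_toAddMonoidHom, AddEquiv.apply_symm_apply] at this
    exact this.symm
  exact IsUnit.of_mul_eq_one_right _ h

/-- If `{}^⊥L = L` then `L` is isotropic. [folklore] -/
theorem isotropic_of_annLeft_eq (b : A →+ A →+ ZMod q) {L : AddSubgroup A} (hmax : annLeft b L = L)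
    {x : A} (hx : x ∈ L) {y : A} (hy : y ∈ L) : b x y = 0 := by
  rw [← hmax] at hx
  exact (mem_annLeft_iff b L x).mp hx y hy

/-- **`#(A ⧸ L) = #L`** for a maximal isotropic `L` under a pairing with bijective adjoint on a finite `A`
killed by `q` (`#{}^⊥L · #L = #A`). [folklore] -/
theorem natCard_quotient_eq_of_annLeft_eq [Finite A] [NeZero q] (hA : ∀ x : A, q • x = 0)
    (b : A →+ A →+ ZMod q) (hb : Bijective b) (L : AddSubgroup A) (hmax : annLeft b L = L) :
    Nat.card (A ⧸ L) = Nat.card L := by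
  have h1 := natCard_annLeft_mul hA b hb L
  rw [hmax] at h1
  have h2 := L.card_eq_card_quotient_mul_card_addSubgroup
  have hpos : 0 < Nat.card L := Nat.card_pos
  exact Nat.eq_of_mul_eq_mul_right hpos (h2.symm.trans h1.symm)

/-- **Descent to the singular quotient, in cyclic currency.** For a bi-additive `b : A × A → ℤ/q` with bijective
adjoint on a finite `A` killed by `q` and a subgroup `L` with `{}^⊥L = L` (maximal isotropic), `b` restricted to
`A × L` factors through `(A ⧸ L) × L` (the shape `H¹_s × H¹_f → ℤ/p^n` of the local Tate pairing modulo the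
finite = Kummer condition) with trivial left kernel; if moreover `L ≅ ℤ/q` (an identification `φ`), then
`A ⧸ L ≅ ℤ/q` by an identification `ψ` in which the pairing is MULTIPLICATION: `b(x, y) = ψ[x] · φ(y)` for all `x ∈ A`, `y ∈ L`
(so in these coordinates the descended pairing is the perfect pairing `B(s, t) = s·t`, `B(1,1) = 1`).
`ψ[x] := b(x, φ⁻¹ 1)`; injective because `φ⁻¹ 1` generates `L` and the left kernel is trivial; bijective by
`#(A ⧸ L) = #L = q`. [folklore] -/
theorem exists_addEquiv_quotient_pairing_eq_mul [Finite A] [NeZero q] (hA : ∀ x : A, q • x = 0)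
    (b : A →+ A →+ ZMod q) (hb : Bijective b) (L : AddSubgroup A) (hmax : annLeft b L = L)
    (φ : L ≃+ ZMod q) :
    ∃ ψ : A ⧸ L ≃+ ZMod q, ∀ (x : A) (y : A) (hy : y ∈ L), b x y = ψ (x : A ⧸ L) * φ ⟨y, hy⟩ := by
  -- the descended pairing `(A ⧸ L) × L → ℤ/q`, `([x], y) ↦ b(x, y)` (`L` is isotropic: `{}^⊥L = L`)
  set sp : A ⧸ L →+ (L →+ ZMod q) := QuotientAddGroup.lift L ((restrictHom L q).comp b) fun x hx =>
    (AddMonoidHom.mem_ker).mpr (AddMonoidHom.ext fun y => by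
      simpa using isotropic_of_annLeft_eq b hmax hx y.2) with hsp
  have hsp_mk : ∀ (x : A) (y : L), sp (x : A ⧸ L) y = b x y := fun x y => rfl
  -- its left kernel is trivial (`{}^⊥L = L`)
  have hsp_inj : Injective sp := by
    rw [injective_iff_map_eq_zero]
    intro xb hxb
    induction xb using QuotientAddGroup.induction_on with
    | H x =>
      rw [QuotientAddGroup.eq_zero_iff, ← hmax, mem_annLeft_iff]
      intro y hy
      have := DFunLike.congr_fun hxb ⟨y, hy⟩
      rwa [hsp_mk] at this
  set g : L := φ.symm 1 with hg
  -- every element of `L` is a multiple of `g`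
  have hgen : ∀ y : L, y = ((φ y).val : ℤ) • g := fun y => by
    apply φ.injective
    rw [map_zsmul, hg, AddEquiv.apply_symm_apply, zsmul_eq_mul, mul_one]
    simp
  set ψ₀ : A ⧸ L →+ ZMod q := sp.flip g with hψ₀
  have hψ₀ : ∀ x : A, ψ₀ (x : A ⧸ L) = b x g := fun x => by
    rw [hψ₀, AddMonoidHom.flip_apply, hsp_mk]
  -- the key identity, for `ψ₀`
  have key : ∀ (x : A) (y : L), b x y = ψ₀ (x : A ⧸ L) * φ y := fun x y => by
    conv_lhs => rw [hgen y]
    rw [AddSubgroup.coe_zsmul, map_zsmul, zsmul_eq_mul, hψ₀, mul_comm]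
    congr 1
    simp
  -- injectivity of `ψ₀`
  have hinj : Injective ψ₀ := by
    rw [injective_iff_map_eq_zero]
    intro xb hxb
    induction xb using QuotientAddGroup.induction_on with
    | H x =>
      apply hsp_inj
      ext y
      rw [hsp_mk, key x y, hxb, zero_mul, map_zero, AddMonoidHom.zero_apply]
  -- counting
  have hcard : Nat.card (ZMod q) ≤ Nat.card (A ⧸ L) := by
    rw [natCard_quotient_eq_of_annLeft_eq hA b hb L hmax, Nat.card_congr φ.toEquiv]
  refine ⟨AddEquiv.ofBijective ψ₀ (hinj.bijective_of_nat_card_le hcard), fun x y hy => ?_⟩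
  rw [AddEquiv.ofBijective_apply]
  exact key x ⟨y, hy⟩

/-- **Two identifications of the singular quotient differ by a unit**: for `ψ : A ⧸ L ≅ ℤ/q` and ANY additive
isomorphism `θ : L ≅ A ⧸ L` (the shape of a finite–singular comparison map at a Kolyvagin prime) and
`φ : L ≅ ℤ/q`, there is a unit `u` with `ψ (θ y) = u · φ y` for all `y ∈ L`. [folklore] -/
theorem exists_isUnit_comparison [NeZero q] {L : AddSubgroup A} (φ : L ≃+ ZMod q) (ψ : A ⧸ L ≃+ ZMod q)
    (θ : L ≃+ A ⧸ L) : ∃ u : ZMod q, IsUnit u ∧ ∀ y : L, ψ (θ y) = u * φ y := by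
  set f : ZMod q ≃+ ZMod q := φ.symm.trans (θ.trans ψ) with hf
  refine ⟨f 1, isUnit_addEquiv_zmod_apply_one f, fun y => ?_⟩
  have h := addMonoidHom_zmod_apply f.toAddMonoidHom (φ y)
  simp only [AddEquiv.coe_toAddMonoidHom, hf, AddEquiv.trans_apply, AddEquiv.symm_apply_apply] at h
  rw [h, mul_comm]
  rfl

/-- Hence the `p`-adic ORDER read through `ψ ∘ θ` is the order read through `φ`:
`ord_p ψ(θ y) = ord_p φ(y)` (`zmodPowOrd` is unit-blind). [folklore] -/
theorem zmodPowOrd_comparison_eq {p n : ℕ} (hp : p.Prime) {L : AddSubgroup A} (φ : L ≃+ ZMod (p ^ n))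
    (ψ : A ⧸ L ≃+ ZMod (p ^ n)) (θ : L ≃+ A ⧸ L) (y : L) :
    zmodPowOrd p n (ψ (θ y)) = zmodPowOrd p n (φ y) := by
  haveI : NeZero (p ^ n) := ⟨pow_ne_zero n hp.ne_zero⟩
  obtain ⟨u, hu, h⟩ := exists_isUnit_comparison φ ψ θ
  rw [h y, zmodPowOrd_mul_of_isUnit hp hu]

/-- **`ord_p` in a cyclic group is identification-blind**: two identifications `ψ, ψ' : C ≅ ℤ/p^n` differ by a
unit, so `ord_p ψ(z) = ord_p ψ'(z)` for every `z` (this is why Kim's reading `ord_p δ̃_ℓ = ord loc^s_p κ_ℓ` may be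
stated with ANY identification of the singular quotient `H¹_s(ℚ_p, E[p^n]) ≅ ℤ/p^n`). [folklore] -/
theorem zmodPowOrd_addEquiv_congr {C : Type*} [AddCommGroup C] {p n : ℕ} (hp : p.Prime)
    (ψ ψ' : C ≃+ ZMod (p ^ n)) (z : C) : zmodPowOrd p n (ψ z) = zmodPowOrd p n (ψ' z) := by
  haveI : NeZero (p ^ n) := ⟨pow_ne_zero n hp.ne_zero⟩
  set f : ZMod (p ^ n) ≃+ ZMod (p ^ n) := ψ'.symm.trans ψ with hf
  have h' : f (ψ' z) = ψ z := by
    rw [hf, AddEquiv.trans_apply, AddEquiv.symm_apply_apply]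
  have h := addMonoidHom_zmod_apply f.toAddMonoidHom (ψ' z)
  rw [AddEquiv.coe_toAddMonoidHom, h'] at h
  rw [h, mul_comm, zmodPowOrd_mul_of_isUnit hp (isUnit_addEquiv_zmod_apply_one f)]

end Algebra

/-! ### §2 At a finite place: the Kummer condition is maximal isotropic on the LEFT; the singular quotient -/

section Local

open WeierstrassCurve Literature.NumberTheory.EllipticCurves Literature.NumberTheory.GaloisRepresentations
  Literature.NumberTheory.GaloisCohomology Field NumberField IsDedekindDomain
open Literature.NumberTheory.GaloisRepresentations.DiscreteGaloisModule (mu MuCarrier)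
open Summit.BirchSwinnertonDyer.Rank1Residual.X11b.Relaxation
open Summit.BirchSwinnertonDyer.Rank1Residual.X11b.KummerPT
open scoped ContRepresentation

variable {K : Type} [Field K] [NumberField K] (W : WeierstrassCurve K) [W.IsElliptic]
variable (n : ℕ) [NeZero n]
variable (e : geomTorsion W n → geomTorsion W n → AlgebraicClosure K)
  (hμ : ∀ S T, e S T ^ n = 1)
  (hadd₁ : ∀ S₁ S₂ T, e (S₁ + S₂) T = e S₁ T * e S₂ T)
  (hadd₂ : ∀ S T₁ T₂, e S (T₁ + T₂) = e S T₁ * e S T₂)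
  (hgal : ∀ (σ : absoluteGaloisGroup K) (S T : geomTorsion W n), σ • e S T = e (σ • S) (σ • T))
  (halt : ∀ T, e T T = 1) (hnondeg : ∀ T, (∀ S, e S T = 1) → T = 0)
  (inv : LocalInvariants K n)

include halt hnondeg in
/-- **The LEFT annihilator of the local Kummer condition under `inv_v(· ∪ₑ ·)` is the Kummer condition**
(`𝓛_v` is maximal isotropic) at a finite place `v` with `inv_v` injective and Tate's count
`#H¹(K_v, E[n]) = #𝓛_v²`: `𝓛_v ≤ {}^⊥𝓛_v` is the Poonen–Rains isotropy and `#{}^⊥𝓛_v · #𝓛_v = #H¹(K_v, E[n])`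
(`natCard_annLeft_mul` with the bijective left adjoint `Relaxation.invWeilPairing_bijective`). Left-handed twin
of `KummerPT.annRight_invWeilPairing_kummer_eq`. [cite: MilneADT2006, Ch. I, Cor. 3.4 and Lemma 6.15]
[cite: PoonenRains2012, Prop. 4.10] -/
theorem annLeft_invWeilPairing_kummer_eq (v : HeightOneSpectrum (𝓞 K)) (hinv : Injective (inv (Sum.inr v)))
    (hEuler : Nat.card (galoisCohomology ((W.torsionGaloisModule n).toLocal (Sum.inr v)) 1) =
      (Nat.card (nsmulAddMonoidHom n : (W.baseChange (v.adicCompletion K)).toAffine.Point →+ _).ker *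
        Nat.card (v.adicCompletionIntegers K ⧸ Ideal.span {(n : v.adicCompletionIntegers K)})) ^ 2) :
    annLeft (invWeilPairing W n e hμ hadd₁ hadd₂ hgal inv (Sum.inr v))
        (W.kummerSelmerStructure (n : ℤ) (Sum.inr v)) =
      W.kummerSelmerStructure (n : ℤ) (Sum.inr v) := by
  haveI := finite_galoisCohomology_toLocal_inr W n v
  set b := invWeilPairing W n e hμ hadd₁ hadd₂ hgal inv (Sum.inr v) with hb
  set L := W.kummerSelmerStructure (n : ℤ) (Sum.inr v) with hL
  have hA := nsmul_galoisCohomology_toLocal_eq_zero W n (Sum.inr v)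
  have hle : L ≤ annLeft b L := fun x hx => (mem_annLeft_iff b L x).mpr fun y hy =>
    invWeilPairing_eq_zero_of_mem W n e hμ hadd₁ hadd₂ hgal halt inv (Sum.inr v) hx hy
  have hmul : Nat.card (annLeft b L) * Nat.card L =
      Nat.card (galoisCohomology ((W.torsionGaloisModule n).toLocal (Sum.inr v)) 1) :=
    natCard_annLeft_mul hA b (invWeilPairing_bijective W n e hμ hadd₁ hadd₂ hgal hnondeg inv v hinv) L
  have hLcard : Nat.card L = Nat.card (nsmulAddMonoidHom n :
        (W.baseChange (v.adicCompletion K)).toAffine.Point →+ _).ker *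
      Nat.card (v.adicCompletionIntegers K ⧸ Ideal.span {(n : v.adicCompletionIntegers K)}) :=
    W.natCard_kummerSelmerStructure_inr v (NeZero.ne n)
  have hLpos : 0 < Nat.card L := Nat.card_pos
  have hcard : Nat.card (annLeft b L) = Nat.card L := by
    apply Nat.eq_of_mul_eq_mul_right hLpos
    rw [hmul, hEuler, hLcard, sq]
  exact (AddSubgroup.eq_of_le_of_card_ge hle hcard.le).symm

include halt hnondeg in
/-- **The singular quotient in cyclic currency.** At a finite place `v` with `inv_v` injective and Tate's count,
given an identification `φ : 𝓛_v ≅ ℤ/n` of the Kummer condition (the FINITE part `H¹_f = E(K_v)/n`, cyclic of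
order `n`), there is an identification `ψ : H¹(K_v, E[n]) ⧸ 𝓛_v ≅ ℤ/n` of the SINGULAR quotient `H¹_s` in which
the local Tate pairing against finite classes is multiplication:
`inv_v(x ∪ₑ y) = ψ[x] · φ(y)` for all `x ∈ H¹(K_v, E[n])`, `y ∈ 𝓛_v` — a perfect pairing
`H¹_s × H¹_f → ℤ/n` between free rank-one `ℤ/n`-modules (`R1-DEPTH-LAW.md` §2 (iii): "the pairing
`H¹_tr × H¹_f → ℤ/p^{k′}` is non-degenerate on both sides (free rank one each)"; at `p`: "factors through
`H¹_s(ℚ_p,W) × H¹_f(ℚ_p,W)`, perfect"). [cite: MilneADT2006, Ch. I, Cor. 2.3 and Cor. 3.4] -/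
theorem exists_addEquiv_singular_pairing_eq_mul (v : HeightOneSpectrum (𝓞 K))
    (hinv : Injective (inv (Sum.inr v)))
    (hEuler : Nat.card (galoisCohomology ((W.torsionGaloisModule n).toLocal (Sum.inr v)) 1) =
      (Nat.card (nsmulAddMonoidHom n : (W.baseChange (v.adicCompletion K)).toAffine.Point →+ _).ker *
        Nat.card (v.adicCompletionIntegers K ⧸ Ideal.span {(n : v.adicCompletionIntegers K)})) ^ 2)
    (φ : W.kummerSelmerStructure (n : ℤ) (Sum.inr v) ≃+ ZMod n) :
    ∃ ψ : galoisCohomology ((W.torsionGaloisModule n).toLocal (Sum.inr v)) 1 ⧸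
        W.kummerSelmerStructure (n : ℤ) (Sum.inr v) ≃+ ZMod n,
      ∀ (x y : galoisCohomology ((W.torsionGaloisModule n).toLocal (Sum.inr v)) 1)
        (hy : y ∈ W.kummerSelmerStructure (n : ℤ) (Sum.inr v)),
        invWeilPairing W n e hμ hadd₁ hadd₂ hgal inv (Sum.inr v) x y = ψ x * φ ⟨y, hy⟩ := by
  haveI := finite_galoisCohomology_toLocal_inr W n v
  exact exists_addEquiv_quotient_pairing_eq_mul (nsmul_galoisCohomology_toLocal_eq_zero W n (Sum.inr v)) _
    (invWeilPairing_bijective W n e hμ hadd₁ hadd₂ hgal hnondeg inv v hinv) _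
    (annLeft_invWeilPairing_kummer_eq W n e hμ hadd₁ hadd₂ hgal halt hnondeg inv v hinv hEuler) φ

/-! ### §3 The identification of the finite part from an identification of `E(K_v)/n` -/

/-- The local Kummer map of `K_v`-rational points lands in the local condition `𝓛_v` of the Kummer Selmer
structure (`Place.Completion (Sum.inr v) = v.adicCompletion K` definitionally). [folklore] -/
theorem localKummerMap_mem_kummerSelmerStructure (v : HeightOneSpectrum (𝓞 K))
    (g : (W.baseChange (v.adicCompletion K)).toAffine.Point) :
    (haveI : CharZero (v.adicCompletion K) := charZero_adicCompletion v
     W.localKummerMap (v.adicCompletion K) (Int.natCast_ne_zero.mpr (NeZero.ne n)) g) ∈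
      W.kummerSelmerStructure (n : ℤ) (Sum.inr v) := by
  haveI : CharZero (v.adicCompletion K) := charZero_adicCompletion v
  exact W.localKummerMap_mem (v.adicCompletion K) _ g

/-- **An identification `φ : E(K_v) ↠ ℤ/n` with kernel `n·E(K_v)` IS an identification of the finite part
`𝓛_v = κ_v(E(K_v)) ≅ E(K_v)/nE(K_v)`**: there is `φL : 𝓛_v ≅ ℤ/n` with `φL(κ_v g) = φ(g)` for every
`g ∈ E(K_v)` (exactness of the local Kummer sequence: `range_localKummerMap`, `ker_localKummerMap`). The
hypothesis shape `φ g = 0 ↔ ∃ h, n • h = g` is the one of the tree's `LocalPointsIdentification` /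
`CyclicSylowQuotient` (`∃ φ : E(ℚ_p) →+ ℤ/p^n` surjective with kernel `p^n·E(ℚ_p)`).
[cite: SilvermanAEC2009, X.§4 diagram (**)] -/
theorem exists_addEquiv_kummer_of_pointIdentification (v : HeightOneSpectrum (𝓞 K))
    (φ : (W.baseChange (v.adicCompletion K)).toAffine.Point →+ ZMod n) (hφ : Surjective φ)
    (hker : ∀ g, φ g = 0 ↔ ∃ h, n • h = g) :
    ∃ φL : W.kummerSelmerStructure (n : ℤ) (Sum.inr v) ≃+ ZMod n,
      ∀ g : (W.baseChange (v.adicCompletion K)).toAffine.Point,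
        φL ⟨_, localKummerMap_mem_kummerSelmerStructure W n v g⟩ = φ g := by
  haveI : CharZero (v.adicCompletion K) := charZero_adicCompletion v
  have hnZ : (n : ℤ) ≠ 0 := Int.natCast_ne_zero.mpr (NeZero.ne n)
  set κ := W.localKummerMap (v.adicCompletion K) hnZ with hκ
  set L := W.kummerSelmerStructure (n : ℤ) (Sum.inr v) with hL
  -- `L = range κ`
  have hrange : ∀ c ∈ L, ∃ g, κ g = c := fun c hc => by
    have : c ∈ κ.range := by
      rw [hκ, W.range_localKummerMap (v.adicCompletion K) hnZ]; exact hc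
    exact this
  -- `κ g = κ g' → φ g = φ g'`
  have hwd : ∀ g g', κ g = κ g' → φ g = φ g' := fun g g' h => by
    have hmem : g - g' ∈ κ.ker := by rw [AddMonoidHom.mem_ker, map_sub, h, sub_self]
    rw [hκ, W.ker_localKummerMap (v.adicCompletion K) hnZ] at hmem
    obtain ⟨d, hd⟩ := hmem
    have h0 : φ (g - g') = 0 := (hker _).mpr ⟨d, by rw [← hd, zsmulAddGroupHom_apply, natCast_zsmul]⟩
    rwa [map_sub, sub_eq_zero] at h0
  -- the map
  set f : L → ZMod n := fun c => φ (hrange c c.2).choose with hf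
  have hfκ : ∀ g, f ⟨κ g, localKummerMap_mem_kummerSelmerStructure W n v g⟩ = φ g := fun g =>
    hwd _ _ (hrange _ (localKummerMap_mem_kummerSelmerStructure W n v g)).choose_spec
  have hfval : ∀ (c : galoisCohomology ((W.torsionGaloisModule n).toLocal (Sum.inr v)) 1) (hc : c ∈ L)
      (g : (W.baseChange (v.adicCompletion K)).toAffine.Point), κ g = c → f ⟨c, hc⟩ = φ g := by
    rintro _ hc g rfl; exact hfκ g
  set fh : L →+ ZMod n :=
    { toFun := f
      map_zero' := (hfval 0 L.zero_mem 0 (map_zero κ)).trans (map_zero φ)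
      map_add' := fun c c' => by
        obtain ⟨g, hg⟩ := hrange c c.2
        obtain ⟨g', hg'⟩ := hrange c' c'.2
        have h1 : f c = φ g := hfval c c.2 g hg
        have h2 : f c' = φ g' := hfval c' c'.2 g' hg'
        have h3 : f (c + c') = φ (g + g') :=
          hfval _ (c + c').2 (g + g') (by rw [map_add, hg, hg']; rfl)
        rw [h1, h2, h3, map_add] } with hfh
  have hinj : Injective fh := by
    rw [injective_iff_map_eq_zero]
    intro c hc
    obtain ⟨g, hg⟩ := hrange c c.2
    have h0 : φ g = 0 := by rw [← hfval c c.2 g hg]; exact hc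
    obtain ⟨h, rfl⟩ := (hker g).mp h0
    apply Subtype.ext
    rw [← hg, map_nsmul, AddSubgroup.coe_zero]
    exact nsmul_galoisCohomology_toLocal_eq_zero W n (Sum.inr v) _
  have hsurj : Surjective fh := fun a => by
    obtain ⟨g, rfl⟩ := hφ a
    exact ⟨⟨κ g, localKummerMap_mem_kummerSelmerStructure W n v g⟩, hfκ g⟩
  exact ⟨AddEquiv.ofBijective fh ⟨hinj, hsurj⟩, fun g => hfκ g⟩

/-- The localisation of a GLOBAL Kummer class `κ_n(P)` at the finite place `v` is the local Kummer class of
`P_{K_v}` (`KummerIndex.res_kummerMapTorsion_eq_localKummerMap`), as an element of `𝓛_v`. [folklore] -/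
theorem localization_kummerMapTorsion_eq_localKummerMap (v : HeightOneSpectrum (𝓞 K)) (P : W.toAffine.Point) :
    galoisCohomology.localization (W.torsionGaloisModule n) (Sum.inr v) 1
        (kummerMapTorsion W n (W.zsmul_geomPoints_surjective_holds (Int.natCast_ne_zero.mpr (NeZero.ne n))) P) =
      (haveI : CharZero (v.adicCompletion K) := charZero_adicCompletion v
       W.localKummerMap (v.adicCompletion K) (Int.natCast_ne_zero.mpr (NeZero.ne n))
        (Affine.Point.baseChange (W' := W) K (v.adicCompletion K) P)) := by
  haveI : CharZero (v.adicCompletion K) := charZero_adicCompletion v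
  exact X11b.KummerIndex.res_kummerMapTorsion_eq_localKummerMap W (v.adicCompletion K)
    (Int.natCast_ne_zero.mpr (NeZero.ne n)) _ P

end Local

end Summit.BirchSwinnertonDyer.Rank1Residual.Ordinary.ReciprocityPT

end
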